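import Summits.Ventures.DiscreteObjects.Hadamard.ConferenceGraph333TwoCells
import Summits.Ventures.DiscreteObjects.Hadamard.ClassSumTrace

/-!
# Every automorphism of srg(333,166,82,83) is an EVEN permutation (kernel)

Framing: lottery ticket; floor = certified bounds/negative ranges.  Cell pub-namedobj (venture DiscreteObjects),
target (H) = `H(668)`, hadamard gen 28; capstone of the automorphism census of `srg(333,166,82,83)` ⇔ symmetric
`C(334)` (⇒ `H(668)`; gen 27).  The census lines for involutions (`f ≡ 1 (mod 4)`), order `4`
(`#Fix τ² ≡ 2·#Fix τ + 3 (mod 8)`) and the parity part of the prime lines are all instances of ONE statement: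
* **`aut_sign_eq_one`** — for the adjacency matrix `A` of an `srg(333,166,82,83)` (hypotheses of
  `ConferenceGraph333`) and ANY permutation `τ` of the vertices preserving adjacency: `Equiv.Perm.sign τ = 1`,
  i.e. `Aut(srg(333,166,82,83)) ≤ Alt(333)`; equivalently the number of `τ`-orbits of even length is even.
  Proof: the `τ`-orbits (the `SameCycle` classes, enumerated as `{τ^k x : k < L}`, `L` the minimal period) form an
  equitable partition of the Seidel matrix; the class-sum matrix `R` has `Σ_i R_{ii} = 0` (`ClassSumTrace`: `R³ = 333R`,
  `333` non-square).  For an orbit of length `L`, `R_{ii} = Σ_{k=1}^{L−1} S_{x,τ^k x}` and `S_{x,τ^{L−k}x} = S_{x,τ^k x}`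
  (invariance + symmetry), so `R_{ii}` is even when `L` is odd and ODD when `L` is even (the middle term `k = L/2` is
  unpaired).  Hence the number of even orbits is even; with Mathlib's `sign_of_cycleType`
  (`sign = (−1)^(#support + #cycles)`) and the bijection 'non-trivial orbits ↔ cycle factors' this is `sign τ = 1`.
* tools: `sum_Ico_reflect_sub`, `perm_minimalPeriod_pos`, `sameCycle_filter_eq_image`, `perm_pow_injOn_range`.
An alternative proof (Galois conjugation of the `±√333`-eigenspaces over `ℚ(√333)`) is sketched in the seat's paper
section; the kernel proof is the orbit-matrix one.  Consequences: no automorphism is a transposition-like odd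
permutation; an involution has `#2-cycles` even (`f ≡ 1 mod 4`, `ConferenceGraph333Involution`), an element of order
`4` has `k₂ + k₄` even (`ConferenceGraph333Order4`), etc.  Structure of a hypothetical object; `C(334)`, `H(668)`
untouched.  Ours (PROVISIONAL).  No `sorry`, no new definitions.
-/

namespace Summit.Ventures.DiscreteObjects.Hadamard

open Finset

section tools

/-- Reflection of `Σ_{k ∈ Ico m L} f k` onto `Σ_{j ∈ Ico 1 (L + 1 - m)} f (L - j)`. -/
theorem sum_Ico_reflect_sub (f : ℕ → ℤ) {m L : ℕ} (hm : 1 ≤ m) (hmL : m ≤ L) :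
    ∑ k ∈ Finset.Ico m L, f k = ∑ j ∈ Finset.Ico 1 (L + 1 - m), f (L - j) := by
  have himg : (Finset.Ico 1 (L + 1 - m)).image (fun j => L - j) = Finset.Ico m L := by
    ext k
    simp only [Finset.mem_image, Finset.mem_Ico]
    constructor
    · rintro ⟨j, hj, rfl⟩; omega
    · intro hk; exact ⟨L - k, by omega, by omega⟩
  rw [← himg, Finset.sum_image (fun j hj j' hj' (h : L - j = L - j') => by
    simp only [Finset.coe_Ico, Set.mem_Ico] at hj hj'; omega)]

end tools

section evenAut
variable {V : Type*} [Fintype V] [DecidableEq V]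

/-- `333` is not a square (private copy). -/
private theorem not_isSquare_333_ev : ¬ IsSquare (333 : ℕ) := by
  rintro ⟨r, hr⟩
  have : r ≤ 19 := by nlinarith
  interval_cases r <;> omega

omit [DecidableEq V] in
/-- Every point of a permutation of a finite type has positive minimal period. -/
theorem perm_minimalPeriod_pos (τ : Equiv.Perm V) (x : V) : 0 < Function.minimalPeriod τ x := by
  refine Function.IsPeriodicPt.minimalPeriod_pos (orderOf_pos τ) ?_
  show (τ : V → V)^[orderOf τ] x = x
  rw [Equiv.Perm.iterate_eq_pow, pow_orderOf_eq_one, Equiv.Perm.one_apply]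

/-- The `SameCycle` class of `x` is `{τ^k x : k < L}`, `L` the minimal period of `x`. -/
theorem sameCycle_filter_eq_image (τ : Equiv.Perm V) (x : V) :
    (univ.filter fun y => τ.SameCycle x y) =
      (Finset.range (Function.minimalPeriod τ x)).image (fun k => (τ ^ k) x) := by
  have hL := perm_minimalPeriod_pos τ x
  ext y
  simp only [Finset.mem_filter, Finset.mem_univ, true_and, Finset.mem_image, Finset.mem_range]
  constructor
  · intro h
    obtain ⟨i, hi⟩ := h.exists_nat_pow_eq
    refine ⟨i % Function.minimalPeriod τ x, Nat.mod_lt _ hL, ?_⟩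
    rw [← hi, ← Equiv.Perm.iterate_eq_pow, ← Equiv.Perm.iterate_eq_pow, Function.iterate_mod_minimalPeriod_eq]
  · rintro ⟨k, -, rfl⟩
    exact Equiv.Perm.sameCycle_pow_right.mpr (Equiv.Perm.SameCycle.refl τ x)

omit [Fintype V] [DecidableEq V] in
/-- Injectivity of `k ↦ τ^k x` below the minimal period. -/
theorem perm_pow_injOn_range (τ : Equiv.Perm V) (x : V) :
    Set.InjOn (fun k => (τ ^ k) x) (Finset.range (Function.minimalPeriod τ x) : Set ℕ) := by
  intro k hk l hl h
  simp only [Finset.coe_range] at hk hl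
  exact Function.iterate_injOn_Iio_minimalPeriod hk hl (by
    simp only [Equiv.Perm.iterate_eq_pow]; exact h)

/-- **Main parity theorem.**  Let `τ` be an adjacency-preserving permutation of an `srg(333,166,82,83)`.  Then
`#support(τ) + #(cycle factors of τ)` is even — equivalently the number of orbits of even length is even —
hence `sign τ = 1`. -/
theorem aut_sign_eq_one (hV : Fintype.card V = 333) (A : Matrix V V ℤ)
    (h01 : ∀ x y, A x y = 0 ∨ A x y = 1) (hsymm : ∀ x y, A y x = A x y) (hdiag : ∀ x, A x x = 0)
    (hk : ∀ x, ∑ y, A x y = 166) (hsrg : ∀ x y, ∑ z, A x z * A z y = 83 * (1 + (if x = y then 1 else 0)) - A x y)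
    (τ : Equiv.Perm V) (hA : ∀ x y, A (τ x) (τ y) = A x y) : Equiv.Perm.sign τ = 1 := by
  classical
  obtain ⟨hSd, hSo, hSs, hS1, hSS⟩ := seidel_identities_of_conferenceGraph A h01 hsymm hdiag 83
    (by rw [hV]; norm_num) (fun x => by rw [hk x]; norm_num) hsrg
  set S : V → V → ℤ := fun x y => 1 - (if x = y then 1 else 0) - 2 * A x y with hS_def
  have hSS' : ∀ x y, ∑ z, S x z * S z y = 333 * (if x = y then 1 else 0) - 1 := fun x y => by
    rw [hSS x y, hV]; norm_num
  have hSτ : ∀ x y, S (τ x) (τ y) = S x y := fun x y => by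
    simp only [hS_def, hA, τ.injective.eq_iff]
  have hSτk : ∀ (k : ℕ) x y, S ((τ ^ k) x) ((τ ^ k) y) = S x y := by
    intro k; induction k with
    | zero => intro x y; simp
    | succ k ih => intro x y; rw [pow_succ', Equiv.Perm.mul_apply, Equiv.Perm.mul_apply, hSτ, ih]
  have hSd' : ∀ x, S x x = 0 := fun x => hSd x
  have hSo' : ∀ x y, x ≠ y → S x y = 1 ∨ S x y = -1 := fun x y => hSo x y
  have hSs' : ∀ x y, S y x = S x y := fun x y => hSs x y
  -- cells = SameCycle classes
  set L : V → ℕ := fun x => Function.minimalPeriod τ x with hL_def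
  have hLpos : ∀ x, 0 < L x := fun x => perm_minimalPeriod_pos τ x
  have hLfix : ∀ x, (τ ^ L x) x = x := fun x => by
    rw [← Equiv.Perm.iterate_eq_pow]; exact Function.iterate_minimalPeriod
  set orb : V → Finset V := fun x => univ.filter (fun y => τ.SameCycle x y) with horb_def
  have horb_mem : ∀ x y, y ∈ orb x ↔ orb y = orb x := by
    intro x y
    simp only [horb_def, Finset.mem_filter, Finset.mem_univ, true_and]
    constructor
    · intro h; ext z
      simp only [Finset.mem_filter, Finset.mem_univ, true_and]
      exact ⟨fun hz => h.trans hz, fun hz => h.symm.trans hz⟩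
    · intro h
      have : y ∈ univ.filter (fun z => τ.SameCycle y z) := by simp [Equiv.Perm.SameCycle.refl]
      rw [h] at this
      simpa using this
  have horb_τ : ∀ y, orb (τ y) = orb y := fun y =>
    (horb_mem y (τ y)).mp (by simp [horb_def, Equiv.Perm.sameCycle_apply_right, Equiv.Perm.SameCycle.refl])
  have horb_img : ∀ x, orb x = (Finset.range (L x)).image (fun k => (τ ^ k) x) := fun x =>
    sameCycle_filter_eq_image τ x
  have horb_card : ∀ x, (orb x).card = L x := fun x => by
    rw [horb_img, Finset.card_image_of_injOn (perm_pow_injOn_range τ x), Finset.card_range]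
  set ι := {j : Finset V // j ∈ univ.image orb} with hι_def
  set cls : V → ι := fun x => ⟨orb x, Finset.mem_image_of_mem _ (Finset.mem_univ x)⟩ with hcls_def
  have hcls_eq : ∀ x y, cls y = cls x ↔ orb y = orb x := fun x y => by
    rw [hcls_def, Subtype.mk.injEq]
  have hcls_τ : ∀ y, cls (τ y) = cls y := fun y => (hcls_eq y (τ y)).mpr (horb_τ y)
  have hcell : ∀ x, (univ.filter fun y => cls y = cls x) = orb x := by
    intro x; ext y
    rw [Finset.mem_filter, hcls_eq, ← horb_mem]
    simp
  have hrep : ∀ i : ι, ∃ x, cls x = i := by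
    rintro ⟨j, hj⟩
    obtain ⟨x, -, hx⟩ := Finset.mem_image.mp hj
    exact ⟨x, Subtype.ext hx⟩
  choose rep hrep using hrep
  have hcellrep : ∀ i : ι, (univ.filter fun y => cls y = i) = orb (rep i) := fun i => by
    rw [← hcell (rep i), hrep]
  set R : Matrix ι ι ℤ := fun i j => ∑ y ∈ univ.filter (fun y => cls y = j), S (rep i) y with hR_def
  have hshift : ∀ r (j : ι), ∑ y ∈ univ.filter (fun y => cls y = j), S (τ r) y =
      ∑ y ∈ univ.filter (fun y => cls y = j), S r y := by
    intro r j
    rw [Finset.sum_filter, Finset.sum_filter]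
    exact Fintype.sum_equiv τ.symm _ _ fun y => by
      rw [show cls y = cls (τ (τ.symm y)) by rw [Equiv.apply_symm_apply], hcls_τ,
        show S (τ r) y = S (τ r) (τ (τ.symm y)) by rw [Equiv.apply_symm_apply], hSτ]
  have hshiftk : ∀ (k : ℕ) r (j : ι), ∑ y ∈ univ.filter (fun y => cls y = j), S ((τ ^ k) r) y =
      ∑ y ∈ univ.filter (fun y => cls y = j), S r y := by
    intro k; induction k with
    | zero => intro r j; simp
    | succ k ih => intro r j; rw [pow_succ', Equiv.Perm.mul_apply, hshift, ih]
  have hR : ∀ x j, ∑ y ∈ univ.filter (fun y => cls y = j), S x y = R (cls x) j := by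
    intro x j
    have hx : x ∈ orb (rep (cls x)) := by rw [horb_mem, ← hcls_eq, hrep]
    rw [horb_img] at hx
    obtain ⟨k, -, hkx⟩ := Finset.mem_image.mp hx
    rw [hR_def]; simp only
    conv_lhs => rw [← hkx]
    exact hshiftk k _ j
  have hids := fun i k => seidel333_classSum_identities S hSs hS1 hSS' cls R hR i k (rep i) (hrep i)
  have htr : ∑ i, R i i = 0 := by
    refine classSum_trace_zero R 333 not_isSquare_333_ev (fun k => ((univ.filter fun y => cls y = k).card : ℤ))
      (fun i => (hids i i).1) fun i k => ?_
    rw [(hids i k).2.1]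
    push_cast
    ring
  -- diagonal entry of the cell of r = rep i, in terms of s k = S r (τ^k r), 1 ≤ k < L r
  have hdiag_sum : ∀ i, R i i = ∑ k ∈ Finset.Ico 1 (L (rep i)), S (rep i) ((τ ^ k) (rep i)) := by
    intro i
    rw [hR_def]; simp only
    rw [hcellrep, horb_img, Finset.sum_image (perm_pow_injOn_range τ (rep i)), Finset.range_eq_Ico,
      ← Finset.sum_Ico_consecutive _ (by omega : 0 ≤ 1) (hLpos (rep i)), Finset.sum_Ico_succ_top (by rfl),
      Finset.Ico_self, Finset.sum_empty, zero_add, pow_zero, Equiv.Perm.one_apply, hSd', zero_add]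
  have hsymk : ∀ r k, 0 < k → k < L r → S r ((τ ^ (L r - k)) r) = S r ((τ ^ k) r) := by
    intro r k hk0 hkL
    rw [← hSτk k r ((τ ^ (L r - k)) r), ← Equiv.Perm.mul_apply, ← pow_add, Nat.add_sub_cancel' hkL.le, hLfix, hSs']
  have hsk : ∀ r k, 0 < k → k < L r → ((S r ((τ ^ k) r) : ℤ) : ZMod 2) = 1 := by
    intro r k hk0 hkL
    have hne : r ≠ (τ ^ k) r := by
      intro e
      have := perm_pow_injOn_range τ r (show 0 ∈ (Finset.range (L r) : Set ℕ) by simp; exact hLpos r)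
        (show k ∈ (Finset.range (L r) : Set ℕ) by simp; exact hkL) (by simp [← e])
      omega
    rcases hSo' _ _ hne with e | e <;> rw [e] <;> decide
  -- parity of the diagonal: odd iff the orbit length is even
  have hdiag_par : ∀ i, ((R i i : ℤ) : ZMod 2) = if 2 ∣ L (rep i) then 1 else 0 := by
    intro i
    set r := rep i with hr
    set s : ℕ → ℤ := fun k => S r ((τ ^ k) r) with hs_def
    have hsum : R i i = ∑ k ∈ Finset.Ico 1 (L r), s k := hdiag_sum i
    have hrefl : ∀ m, 1 ≤ m → m ≤ L r →
        ∑ k ∈ Finset.Ico m (L r), s k = ∑ j ∈ Finset.Ico 1 (L r + 1 - m), s j := by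
      intro m hm hmL
      rw [sum_Ico_reflect_sub s hm hmL]
      refine Finset.sum_congr rfl fun j hj => ?_
      rw [Finset.mem_Ico] at hj
      exact hsymk r j (by omega) (by omega)
    split_ifs with hev
    · -- L = 2h, h ≥ 1
      obtain ⟨h, hh⟩ := hev
      have hh1 : 1 ≤ h := by have := hLpos r; omega
      have e1 : ∑ k ∈ Finset.Ico 1 (L r), s k =
          ∑ k ∈ Finset.Ico 1 h, s k + (s h + ∑ k ∈ Finset.Ico (h + 1) (L r), s k) := by
        rw [← Finset.sum_Ico_consecutive _ hh1 (by omega : h ≤ L r), Finset.sum_eq_sum_Ico_succ_bot (by omega : h < L r)]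
      have e2 : ∑ k ∈ Finset.Ico (h + 1) (L r), s k = ∑ k ∈ Finset.Ico 1 h, s k := by
        rw [hrefl (h + 1) (by omega) (by omega), show L r + 1 - (h + 1) = h by omega]
      rw [hsum, e1, e2, show ∑ k ∈ Finset.Ico 1 h, s k + (s h + ∑ k ∈ Finset.Ico 1 h, s k) =
        2 * ∑ k ∈ Finset.Ico 1 h, s k + s h by ring]
      push_cast
      rw [show (2 : ZMod 2) = 0 from rfl, zero_mul, zero_add, hs_def]
      exact hsk r h (by omega) (by omega)
    · -- L = 2h+1
      set h := L r / 2 with hh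
      have hL : L r = 2 * h + 1 := by omega
      have e1 : ∑ k ∈ Finset.Ico 1 (L r), s k =
          ∑ k ∈ Finset.Ico 1 (h + 1), s k + ∑ k ∈ Finset.Ico (h + 1) (L r), s k := by
        rw [← Finset.sum_Ico_consecutive _ (by omega : 1 ≤ h + 1) (by omega : h + 1 ≤ L r)]
      have e2 : ∑ k ∈ Finset.Ico (h + 1) (L r), s k = ∑ k ∈ Finset.Ico 1 (h + 1), s k := by
        rw [hrefl (h + 1) (by omega) (by omega), show L r + 1 - (h + 1) = h + 1 by omega]
      rw [hsum, e1, e2, ← two_mul]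
      push_cast
      rw [show (2 : ZMod 2) = 0 from rfl, zero_mul]
  -- number of cells with even orbit length is even
  set E := (univ : Finset ι).filter (fun i => 2 ∣ L (rep i)) with hE_def
  have hEeven : 2 ∣ E.card := by
    have hcast : ((∑ i, R i i : ℤ) : ZMod 2) = (E.card : ZMod 2) := by
      rw [Int.cast_sum, Finset.sum_congr rfl fun i _ => hdiag_par i, Finset.sum_ite, Finset.sum_const_zero, add_zero,
        Finset.sum_const]
      simp [hE_def]
    rw [htr, Int.cast_zero] at hcast
    exact (ZMod.natCast_eq_zero_iff _ 2).mp hcast.symm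
  -- relate to the cycle structure of τ
  -- (a) #support = Σ over non-fixed cells of L
  have h333 : ∑ i : ι, L (rep i) = 333 := by
    rw [← hV, ← Finset.card_univ, Finset.card_eq_sum_card_fiberwise (f := cls) (t := univ)
      fun _ _ => Finset.mem_univ _]
    exact (Finset.sum_congr rfl fun i _ => by rw [hcellrep, horb_card]).symm
  have hLone : ∀ x, L x = 1 ↔ τ x = x := fun x => Function.minimalPeriod_eq_one_iff_isFixedPt
  have hfix : (univ.filter fun x => τ x = x).card = ((univ : Finset ι).filter fun i => τ (rep i) = rep i).card := by
    rw [Finset.card_eq_sum_card_fiberwise (f := cls) (s := univ.filter fun x => τ x = x) (t := univ)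
      fun _ _ => Finset.mem_univ _, Finset.card_eq_sum_ones, Finset.sum_filter]
    refine Finset.sum_congr rfl fun i _ => ?_
    have hset : (univ.filter fun x => τ x = x).filter (fun x => cls x = i) =
        (orb (rep i)).filter (fun x => τ x = x) := by
      ext y
      rw [Finset.mem_filter, Finset.mem_filter, Finset.mem_filter, ← hcellrep i, Finset.mem_filter]
      tauto
    rw [hset]
    split_ifs with hfx
    · have h1 : (orb (rep i)).card = 1 := by rw [horb_card, hLone]; exact hfx
      obtain ⟨z, hz⟩ := Finset.card_eq_one.mp h1
      have hself : rep i ∈ orb (rep i) := by simp [horb_def, Equiv.Perm.SameCycle.refl]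
      rw [hz, Finset.mem_singleton] at hself
      rw [hz, Finset.filter_singleton, if_pos (by rw [← hself]; exact hfx), Finset.card_singleton]
    · rw [Finset.card_eq_zero, Finset.filter_eq_empty_iff]
      intro y hy e
      apply hfx
      -- y fixed and SameCycle (rep i) y ⇒ rep i = y
      have hy' : τ.SameCycle (rep i) y := by simpa [horb_def] using hy
      obtain ⟨j, hj⟩ := hy'.symm.exists_nat_pow_eq
      rw [Equiv.Perm.pow_apply_eq_self_of_apply_eq_self e] at hj
      rw [← hj, e]
  -- (b) number of cycle factors = number of non-fixed cells
  have hcyc : τ.cycleFactorsFinset.card = ((univ : Finset ι).filter fun i => τ (rep i) ≠ rep i).card := by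
    symm
    refine Finset.card_bij (fun i _ => τ.cycleOf (rep i)) (fun i hi => ?_) (fun i hi i' hi' h => ?_)
      (fun c hc => ?_)
    · exact Equiv.Perm.cycleOf_mem_cycleFactorsFinset_iff.mpr (Equiv.Perm.mem_support.mpr (Finset.mem_filter.mp hi).2)
    · have hi2 := (Finset.mem_filter.mp hi').2
      have hmem : rep i' ∈ (τ.cycleOf (rep i)).support := by
        rw [h]; exact Equiv.Perm.mem_support_cycleOf_iff.mpr ⟨Equiv.Perm.SameCycle.refl _ _, Equiv.Perm.mem_support.mpr hi2⟩
      have hsc : τ.SameCycle (rep i) (rep i') := (Equiv.Perm.mem_support_cycleOf_iff.mp hmem).1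
      have : orb (rep i') = orb (rep i) := (horb_mem (rep i) (rep i')).mp (by simpa [horb_def] using hsc)
      rw [← hrep i, ← hrep i']
      exact ((hcls_eq (rep i) (rep i')).mpr this).symm
    · obtain ⟨hcyc, hca⟩ := Equiv.Perm.mem_cycleFactorsFinset_iff.mp hc
      obtain ⟨a, ha⟩ := hcyc.nonempty_support
      have hτa : τ a ≠ a := by rw [← hca a ha]; exact Equiv.Perm.mem_support.mp ha
      refine ⟨cls a, Finset.mem_filter.mpr ⟨Finset.mem_univ _, fun e => ?_⟩, ?_⟩
      · -- rep (cls a) fixed ⇒ its orbit is a singleton containing a ⇒ a fixed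
        have hmem : a ∈ orb (rep (cls a)) := by rw [horb_mem, ← hcls_eq, hrep]
        have h1 : (orb (rep (cls a))).card = 1 := by rw [horb_card, hLone]; exact e
        obtain ⟨z, hz⟩ := Finset.card_eq_one.mp h1
        have hself : rep (cls a) ∈ orb (rep (cls a)) := by simp [horb_def, Equiv.Perm.SameCycle.refl]
        rw [hz, Finset.mem_singleton] at hmem hself
        exact hτa (by rw [hmem, ← hself, e, hself])
      · have hsc : τ.SameCycle (rep (cls a)) a := by
          have hmem : a ∈ orb (rep (cls a)) := by rw [horb_mem, ← hcls_eq, hrep]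
          simpa [horb_def] using hmem
        rw [(Equiv.Perm.cycle_is_cycleOf ha hc : c = τ.cycleOf a)]
        exact hsc.cycleOf_eq
  -- (c) the sign
  rw [Equiv.Perm.sign_of_cycleType, Equiv.Perm.sum_cycleType, Equiv.Perm.cycleType_def, Multiset.card_map,
    Finset.card_val, hcyc]
  -- #support + #nonfixed cells is even
  have hsupp : τ.support.card + (univ.filter fun x => τ x = x).card = 333 := by
    rw [← hV, ← Finset.card_univ, Equiv.Perm.support]
    convert Finset.card_filter_add_card_filter_not (s := (univ : Finset V)) (fun x => τ x ≠ x) using 3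
    ext x; simp
  have hcells : ((univ : Finset ι).filter fun i => τ (rep i) = rep i).card +
      ((univ : Finset ι).filter fun i => τ (rep i) ≠ rep i).card = (univ : Finset ι).card :=
    Finset.card_filter_add_card_filter_not _
  -- Σ L over cells, split by parity: Σ_i L_i ≡ #odd cells (mod 2); fixed cells are odd (L = 1)
  have hpar : (∑ i : ι, L (rep i)) % 2 = ((univ : Finset ι).card - E.card) % 2 := by
    have hsplit := Finset.sum_filter_add_sum_filter_not (univ : Finset ι) (fun i => 2 ∣ L (rep i)) (fun i => L (rep i))
    have h1 : 2 ∣ ∑ i ∈ univ.filter (fun i => 2 ∣ L (rep i)), L (rep i) :=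
      Finset.dvd_sum fun i hi => (Finset.mem_filter.mp hi).2
    have h2 : (∑ i ∈ univ.filter (fun i => ¬ 2 ∣ L (rep i)), L (rep i)) % 2 =
        (univ.filter (fun i : ι => ¬ 2 ∣ L (rep i))).card % 2 := by
      rw [Finset.sum_nat_mod, Finset.sum_congr rfl (g := fun _ => 1) (fun i hi => by
        have := (Finset.mem_filter.mp hi).2; omega), ← Finset.card_eq_sum_ones]
    have h3 := Finset.card_filter_add_card_filter_not (s := (univ : Finset ι)) (fun i => 2 ∣ L (rep i))
    rw [← hE_def] at h3
    obtain ⟨q, hq⟩ := h1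
    omega
  -- fixed cells ⊆ odd cells; E ⊆ nonfixed cells
  have hEsub : E.card + ((univ : Finset ι).filter fun i => τ (rep i) = rep i).card ≤
      (univ : Finset ι).card := by
    rw [← Finset.card_union_of_disjoint]
    · exact Finset.card_le_univ _
    · rw [Finset.disjoint_filter]
      intro i _ hev hfx
      rw [(hLone (rep i)).mpr hfx] at hev
      omega
  obtain ⟨m, hm⟩ := hEeven
  have hexp : (τ.support.card + ((univ : Finset ι).filter fun i => τ (rep i) ≠ rep i).card) % 2 = 0 := by
    omega
  obtain ⟨e, he⟩ : 2 ∣ τ.support.card + ((univ : Finset ι).filter fun i => τ (rep i) ≠ rep i).card :=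
    Nat.dvd_of_mod_eq_zero hexp
  simp [he, pow_mul]

end evenAut

end Summit.Ventures.DiscreteObjects.Hadamard
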